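import Literature.RepresentationTheory.BorelWallach2000.UpqHodgeBigrading
import HarnessLib

/-!
# Liu 2021, Appendix D, Lemma D.2 (`le:weil_arch`) and the paragraph before it — EXACTLY AS PRINTED, over the tree's
# `(𝔤, K)`-modules of the real group `U(p,q)_ℝ = uFormGroup α β`; statement-exact typing, no proof

[Liu2021] = Yifeng Liu, *Fourier–Jacobi cycles and arithmetic relative trace formula* (with an appendix by Chao Li and
Yihang Zhu), Cambridge J. Math. **9** (2021), no. 1, 1–147 = arXiv:2102.11518.  PRIMARY SOURCE READ FOR THIS FILE: the
author's TeX source of the arXiv v2 e-print (`FJcycle.tex` = `main.tex` of the arXiv source bundle, md5 `6db49a74122d…`,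
the file read by `LemD1AsPrinted` / `Thm418AsPrinted` in this directory); every `l. NNNN` below is a line of that file
(numbering = arXiv v2 = journal: Appendix D «Cohomology of unitary Shimura curves», §D.1 «Oscillator representations of
local unitary groups»; the held extraction `paper:arxiv-2102.11518` calls this lemma «Lemma 10.2», chunk p0057).  This is
**Lemma D.2**, TeX label `le:weil_arch`, l. 5279–5289, the ARCHIMEDEAN companion of Lemma D.1 (`LemD1AsPrinted`, same
directory), together with the two paragraphs l. 5265–5276 that fix its notation.  It is the «`LiuLemD2_2`» interface row
of the cell hodgecm-mathlib (A-plan2's v2 split of `stub_mainGalois`, 2026-08-28; B3-DAG row B3-14): Liu uses item (2) in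
the proof of Prop. 4.13 (l. 2140: «By Lemma D.2, we know that `μ` is of weight one and `ε_e` is `μ`-admissible. Moreover,
`H¹(𝔤, K_G; π_∞)` is of dimension `1`») and items (1)/(3) in App. D (l. 5359).

## The printed text (verbatim; TeX macros resolved: `\rU` = `U`, `\dR` = `ℝ`, `\dC` = `ℂ`, `\fu` = `𝔲`, `\rK` = `K`, `\rH` = `H`)

**Notation**, l. 5265–5272: «Now we take `F = ℝ` and `E = ℂ`. Let `(p,q)` be the signature of `V`. Then we may identify
`U(V)` with `U(p,q)_ℝ`, the subgroup of `Res_{ℂ/ℝ} GL_n` of elements preserving the hermitian form given by the matrix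
`(I_p 0; 0 −I_q)`. Denote by `𝔲_{p,q}` the Lie algebra of `U(p,q)_ℝ` and fix a maximal compact subgroup `K_{p,q}` of
`U(p,q)_ℝ(ℝ)`. In the construction of `ω(μ,ε,χ)`, the three parameters have the following possibilities:
`μ_m(z) = arg(z)^m`, `m` odd integer; `ε = ±i`; `χ_l(z) = z^l`, `l ∈ ℤ`.  To shorten notation, we denote by
`ω_{p,q}^{m,±,l}` the representation `ω(μ_m, ±i, χ_l)` of `U(p,q)_ℝ`. It is well-known (see, for example, [SW78]*Section 4)
that `ω_{p,q}^{m,±,l}` is irreducible.»  («the construction of `ω(μ,ε,χ)`» = the three steps of §D.1, l. 5215–5222,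
quoted in `LemD1AsPrinted`: `ω(ε)` the oscillator representation of `Mp(V_ε)` for `ψ_F`, `ω(μ,ε) := ω(ε) ∘ ι_μ`,
`ω(μ,ε,χ)` := the maximal quotient of `ω(μ,ε)` on which the centre `E^1 = U(1)` of `U(V)` acts by `χ`.)

**The paragraph before the lemma**, l. 5274–5276: «By the computation in [BMM]*Section 5, up to equivalence, there are
only two irreducible unitary representations `π` of `U(n−1,1)_ℝ` such that `H¹(𝔲_{n−1,1}, K_{n−1,1}; π) ≠ {0}`, in which
case the cohomology has dimension `1` for both representations. Let us label them by `π_{n−1,1}^{1,0}` and `π_{n−1,1}^{0,1}`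
in the way that `H¹(𝔲_{n−1,1}, K_{n−1,1}; π_{n−1,1}^{1,0})` and `H¹(𝔲_{n−1,1}, K_{n−1,1}; π_{n−1,1}^{0,1})` have Hodge types
`(1,0)` and `(0,1)`, respectively.»

**LEMMA D.2** (l. 5279–5289): «Let the notation be as above.
 (1) Among the representations `ω_{n,0}^{m,±,l}`, only `ω_{n,0}^{1,+,0}` and `ω_{n,0}^{−1,−,0}` are the trivial character.
 (2) If `n ≥ 3`, then in the set `{ω_{n−1,1}^{m,±,l}}`, only `ω_{n−1,1}^{−1,−,0}` (resp. `ω_{n−1,1}^{1,+,0}`) is isomorphic to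
     `π_{n−1,1}^{1,0}` (resp. `π_{n−1,1}^{0,1}`).
 (3) If `n = 2`, then in the set `{ω_{1,1}^{m,±,l}}`, only `ω_{1,1}^{−1,−,0}` and `ω_{1,1}^{1,−,0}` (resp. `ω_{1,1}^{1,+,0}` and
     `ω_{1,1}^{−1,+,0}`) are isomorphic to `π_{1,1}^{1,0}` (resp. `π_{1,1}^{0,1}`).»
Proof as printed (l. 5291–5294, NOT formalised): «The explicit formulae for the `K_{p,q}`-type of `ω_{p,q}^{m,±,l}` can be
found in, for example, [KK07]*Theorem 5.4 with `p′ + q′ = 1`. In particular, (1) follows directly.  For (2) and (3), it is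
shown in [BMM]*Section 5 that both `π_{n−1,1}^{1,0}` and `π_{n−1,1}^{0,1}` are isomorphic to some `ω_{n−1,1}^{m,±,l}`. Comparing
the formula for the highest weights in [BMM]*5.7 with `p = n−1, q = 1, a + b = 1 (≤ p)` with [KK07]*Theorem 5.4, we obtain
the assertions.»  (The standing hypothesis of §D.1, l. 5213, is «rank `n ≥ 2`».)

## The typing (paper order; `⟨CARRIER⟩` = posited datum, as in `LemD1AsPrinted` / `Thm418AsPrinted`)

* THE GROUP IS REAL.  «`U(p,q)_ℝ`, the subgroup of `Res_{ℂ/ℝ} GL_n` of elements preserving the hermitian form given by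
  `(I_p 0; 0 −I_q)`» is VERBATIM the tree's linear real group `uFormGroup α β : RealMatrixGroup ℂ (α ⊕ β)`
  (`Literature.RepresentationTheory.KonnoKonno2007`, file `JunctionLinearRealGroup`: the unitary group of
  `signForm α β = diag(1_α, −1_β)`, `|α| = p`, `|β| = q`), with «`𝔲_{p,q}`» = `(uFormGroup α β).lie` and «a maximal
  compact subgroup `K_{p,q}`» = `(uFormGroup α β).maximalCompact = U(p,q) ∩ U(n) = U(p) × U(q)` (READING L1: the lemma
  does not depend on the choice of `K_{p,q}`; the tree's is the standard one).  The `U(2,1) × U(1)` JUNCTION of the cell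
  (`KonnoKonno2007.JunctionInstanceU21U1`, row B3-14) is the case `(α, β) = (Fin 2, Unit)`.
* THE CATEGORY.  READING L2: «representation of `U(p,q)_ℝ`», «irreducible unitary representation», «isomorphic», «up
  to equivalence» are read on HARISH-CHANDRA MODULES — the tree's `(𝔤, K)`-modules of `uFormGroup α β`
  (`Literature.NumberTheory.Automorphic.IsGKModule`, Wallach §3.3.1), «isomorphic»/«equivalent» = `AreGKEquivalent`
  (a `GKEquiv` exists), «irreducible» = `IsIrreducibleGK`, «unitary» = INFINITESIMALLY UNITARY (`LemD2.IsInfUnitary`: an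
  invariant positive-definite Hermitian form, [BorelWallach2000, 0 §2.5] — the shape of the tree's `U(1,1)` predicate
  `BorelWallach2000.U11Unitary.IsUnitaryGK`, here for `U(p,q)`).  This is the reading under which the lemma is USED
  (l. 2140, l. 5359: `π_∞` enters only through `H¹(𝔤, K_G; π_∞)`), and it loses nothing: for irreducible unitary
  representations, unitary equivalence = infinitesimal equivalence of the Harish-Chandra modules (Harish-Chandra; tree
  records `isIrreducibleGK_of_isTopIrreducible_unitary`, `isAdmissibleGK_of_irreducible_unitary` in `GKModules`).
  «`H¹(𝔲_{p,q}, K_{p,q}; π)`» = the tree's relative Lie algebra cohomology `gkCohomology (uFormGroup α β) ρK ρ𝔤 _ 1`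
  [BorelWallach2000, I §5.1]; «has Hodge type `(1,0)`» (resp. `(0,1)`) = every class has `J`-type `δ = +1` (resp. `−1`):
  `BorelWallach2000.upqTypeClasses ρK ρ𝔤 _ 1 1 = ⊤` (resp. `… 1 (−1) = ⊤`) — [BorelWallach2000, II §4.1–4.2]
  `C^{a,b} = C^{a+b}_{a−b} = Hom_K(Λ^a 𝔭⁺ ⊗ Λ^b 𝔭⁻, V)` with `𝔭⁺` the upper-right block, which IS [BMM16]'s `𝔭′` =
  «type `(1,0)`» (tree: `BergeronMillsonMoeglin2016.HodgeTypeSign.typeSummand_one_zero`, file `HodgeTypeSignConvention`,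
  the convention `D_BMM` under which Liu's labels `π^{1,0}`, `π^{0,1}` are read — READING L3, cited, not restated).
* THE INDEX SET IS REAL: `LemD2.Idx` = triples `(m, ±, l)`, `m` an odd integer, a sign `±` (the parameter `ε = ±i`), `l ∈ ℤ`.
* ⟨CARRIER⟩ `LemD2.Family α β`: for every index `i = (m, ±, l)` a `(𝔤, K)`-module `(V i, ρK i, ρ𝔤 i)` of `uFormGroup α β`
  = the Harish-Chandra module of «`ω_{p,q}^{m,±,l} = ω(μ_m, ±i, χ_l)`» (object-match duty (om): Steps 1–3 of §D.1 at `F = ℝ`,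
  `E = ℂ`, `V = (ℂ^n, diag(I_p, −I_q))`, `ψ_ℝ` the standard additive character, `ι_{μ_m}` the splitting of [HKS, §1] for
  `μ_m(z) = arg(z)^m = (z/|z|)^m`, then the maximal `χ_l`-quotient for the centre; in the Fock model its `K_{p,q}`-finite
  vectors are polynomials — [KK07, Lemma 5.2, Thm. 5.4], tree `KonnoKonno2007.FockModelUnitaryDualPair` §4 for the
  dictionary at the junction).  Not constructible in the tree today as a `(𝔤, K)`-module; posited, exactly as `LemD1Family`
  posits `ω(μ, ε)`.
* ⟨CARRIER⟩ `LemD2.CohPair α β`: the two `(𝔤, K)`-modules «`π^{1,0}_{n−1,1}`», «`π^{0,1}_{n−1,1}`»; the paragraph l. 5274–5276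
  that DEFINES the labels is typed as the predicate `CohPair.AsPrinted` (irreducible, unitary, `H¹ ≠ 0` of dimension `1` and
  of Hodge type `(1,0)` / `(0,1)`; and every irreducible unitary `(𝔤, K)`-module with `H¹ ≠ 0` is equivalent to one of
  them).  READING L4: «only two … up to equivalence» = the exhaustion clause + `π^{1,0} ≄ π^{0,1}`.
* `LemD2_1AsPrinted` (signature `(n,0)`: `β` empty; «is the trivial character» = equivalent to the trivial one-dimensional
  `(𝔤, K)`-module `(ℂ, 1, 0)`, READING L5), `LemD2_2AsPrinted` (`|β| = 1`, «`n ≥ 3`» ⇔ `|α| ≥ 2`), `LemD2_3AsPrinted`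
  (`|α| = |β| = 1`), each «only X (and Y) is/are isomorphic to `π`» typed as an `↔` over ALL indices; and
  `Family.IrreducibleAsPrinted` (l. 5272, [SW78, §4]).
* As for every record of this directory: these are PREDICATES on the consumer's data `D`, `C`; NOTHING IS ASSERTED;
  `∀ D C, LemD2_2AsPrinted D C` is not Liu's lemma (the carriers are posited) and no declaration here has that type.
  0 new named facts (`def X : Prop` without arguments): every `def` below is a definition with a body or a predicate.

NOT here: the proof ([KK07] Thm. 5.4 `K`-type formulae, [BMM16] §5 / 5.7); `ω_{p,q}^{m,±,l}` as a constructed object; the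
non-archimedean Lemma D.1 (`LemD1AsPrinted`); the global statements that consume the lemma (Prop. 4.13, Thm. 4.15, Thm. D.6).

## References
* [Liu2021] Y. Liu, Camb. J. Math. 9 (2021) = arXiv:2102.11518, App. D §D.1: l. 5265–5276 (notation, `π^{1,0}`, `π^{0,1}`),
  Lemma D.2 l. 5279–5289 (label `le:weil_arch`), proof l. 5291–5294; uses: l. 2140 (proof of Prop. 4.13), l. 5359.
* [KonnoKonno2007] T. Konno, K. Konno, Kyushu J. Math. 61 (2007) 35–82, Thm. 5.4 p. 75 (the `K`-types; cited through the proof).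
* [BergeronMillsonMoeglin2016Balls] N. Bergeron, J. Millson, C. Moeglin, Acta Math. 216 (2016), §5, §5.7 (journal numbering).
* [SternbergWolf1978] S. Sternberg, J. A. Wolf, Trans. AMS 238 (1978) 1–43, §4 (irreducibility of `ω_{p,q}^{m,±,l}`).
* [BorelWallach2000] A. Borel, N. Wallach, Math. Surveys Monogr. 67 (2000), 0 §2.5 (unitary `(𝔤,K)`-modules), I §5.1
  (`H^•(𝔤, K; V)`), II §4.1–4.2 (Hodge types `C^{a,b}`).
-/

noncomputable section

namespace Literature.NumberTheory.Automorphic.Liu2021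

open Literature.NumberTheory.Automorphic
open Literature.RepresentationTheory.KonnoKonno2007
open Literature.RepresentationTheory.BorelWallach2000

-- Mathlib idiom (Mathlib `Algebra.Lie.OfAssociative`; the tree's `GKModules`, `GKCohomology`, `UpqHodgeBigrading`):
-- the commutator bracket on `Module.End ℂ V`, without which the type `𝔤 →ₗ⁅ℝ⁆ Module.End ℂ V` of a `(𝔤, K)`-module
-- does not elaborate (`LieRing.ofAssociativeRing` is a `def` in Mathlib, opened locally by every user).
attribute [local instance 100] LieRing.ofAssociativeRing

namespace LemD2

/-! ## §0 The index set `(m, ±, l)` and the adjectives -/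

/-- «the three parameters have the following possibilities: `μ_m(z) = arg(z)^m`, `m` odd integer; `ε = ±i`; `χ_l(z) = z^l`,
`l ∈ ℤ`» — the index of `ω_{p,q}^{m,±,l} = ω(μ_m, ±i, χ_l)`: an odd integer `m`, a sign (`SignType.pos` = «`+`», i.e.
`ε = +i`; `SignType.neg` = «`−`», `ε = −i`), an integer `l`. [cite: Liu2021, App. D l. 5267–5272] -/
structure Idx : Type where
  /-- the odd integer `m` of `μ_m(z) = arg(z)^m` -/
  m : ℤ
  /-- «`m` odd integer» -/
  odd_m : Odd m
  /-- the sign `±` of `ε = ±i` -/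
  sgn : SignType
  /-- the sign is `+` or `−` -/
  sgn_ne_zero : sgn ≠ 0
  /-- the integer `l` of `χ_l(z) = z^l` -/
  l : ℤ

/-- `i.Is m s l`: the index `i` is `(m, s, l)` — e.g. `i.Is (-1) (-1) 0` reads «`i = (−1, −, 0)`», the index of
`ω^{−1,−,0}`. [cite: Liu2021, App. D l. 5272] -/
def Idx.Is (i : Idx) (m : ℤ) (s : SignType) (l : ℤ) : Prop :=
  i.m = m ∧ i.sgn = s ∧ i.l = l

/-- unfolding of `Idx.Is`. [cite: Liu2021, App. D l. 5272] -/
theorem Idx.is_iff (i : Idx) (m : ℤ) (s : SignType) (l : ℤ) : i.Is m s l ↔ i.m = m ∧ i.sgn = s ∧ i.l = l :=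
  Iff.rfl

/-- the index `(−1, −, 0)` of `ω^{−1,−,0}` (non-vacuity of `Idx`). [cite: Liu2021, App. D Lem. D.2 (2), l. 5284] -/
def Idx.negOneMinusZero : Idx where
  m := -1
  odd_m := by decide
  sgn := SignType.neg
  sgn_ne_zero := by decide
  l := 0

/-- `Idx.negOneMinusZero` is `(−1, −, 0)`. [cite: Liu2021, App. D Lem. D.2 (2), l. 5284] -/
theorem Idx.negOneMinusZero_is : Idx.negOneMinusZero.Is (-1) (-1) 0 :=
  ⟨rfl, rfl, rfl⟩

variable (α β : Type) [Fintype α] [DecidableEq α] [Fintype β] [DecidableEq β]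

section Adjectives

variable {α β}
variable {V : Type*} [AddCommGroup V] [Module ℂ V]
  (ρK : Representation ℂ (uFormGroup α β).maximalCompact V) (ρ𝔤 : (uFormGroup α β).lie →ₗ⁅ℝ⁆ Module.End ℂ V)

/-- «unitary» for a `(𝔤, K)`-module `(ρK, ρ𝔤)` of `U(p,q)_ℝ` (READING L2): INFINITESIMALLY UNITARY — there is a Hermitian
form `B` (conjugate-linear in the first variable), positive definite, for which every `ρ𝔤(Y)`, `Y ∈ 𝔲_{p,q}`, is
skew-Hermitian and `K_{p,q}` acts by `B`-unitary operators (the shape of `BorelWallach2000.U11Unitary.IsUnitaryGK`, for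
`U(p,q)`). [cite: BorelWallach2000, 0 §2.5] -/
def IsInfUnitary : Prop :=
  ∃ B : V →ₗ⋆[ℂ] V →ₗ[ℂ] ℂ,
    (∀ x y : V, B x y = starRingEnd ℂ (B y x)) ∧ (∀ x : V, x ≠ 0 → 0 < (B x x).re) ∧
      (∀ (Y : (uFormGroup α β).lie) (x y : V), B (ρ𝔤 Y x) y = -B x (ρ𝔤 Y y)) ∧
        ∀ (k : (uFormGroup α β).maximalCompact) (x y : V), B (ρK k x) (ρK k y) = B x y

/-- unfolding of `IsInfUnitary`. [cite: BorelWallach2000, 0 §2.5] -/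
theorem isInfUnitary_iff : IsInfUnitary ρK ρ𝔤 ↔ ∃ B : V →ₗ⋆[ℂ] V →ₗ[ℂ] ℂ,
    (∀ x y : V, B x y = starRingEnd ℂ (B y x)) ∧ (∀ x : V, x ≠ 0 → 0 < (B x x).re) ∧
      (∀ (Y : (uFormGroup α β).lie) (x y : V), B (ρ𝔤 Y x) y = -B x (ρ𝔤 Y y)) ∧
        ∀ (k : (uFormGroup α β).maximalCompact) (x y : V), B (ρK k x) (ρK k y) = B x y :=
  Iff.rfl

/-- «is the trivial character» (item (1), READING L5): the `(𝔤, K)`-module is equivalent to the trivial one-dimensional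
`(𝔤, K)`-module `ℂ` (`K` acting by `1`, `𝔲_{p,q}` by `0`). [cite: Liu2021, App. D Lem. D.2 (1), l. 5282] -/
def IsTrivialCharacter : Prop :=
  AreGKEquivalent ρK ρ𝔤 (1 : Representation ℂ (uFormGroup α β).maximalCompact ℂ)
    (0 : (uFormGroup α β).lie →ₗ⁅ℝ⁆ Module.End ℂ ℂ)

/-- unfolding of `IsTrivialCharacter`. [cite: Liu2021, App. D Lem. D.2 (1), l. 5282] -/
theorem isTrivialCharacter_iff : IsTrivialCharacter ρK ρ𝔤 ↔
    AreGKEquivalent ρK ρ𝔤 (1 : Representation ℂ (uFormGroup α β).maximalCompact ℂ)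
      (0 : (uFormGroup α β).lie →ₗ⁅ℝ⁆ Module.End ℂ ℂ) :=
  Iff.rfl

end Adjectives

/-! ## §1 The carriers: the family `{ω_{p,q}^{m,±,l}}` and the pair `(π^{1,0}, π^{0,1})` -/

/-- ⟨CARRIER⟩ **the family `{ω_{p,q}^{m,±,l}}_{(m,±,l)}` of [Liu2021, App. D l. 5272]** as `(𝔤, K)`-modules of
`U(p,q)_ℝ = uFormGroup α β` (`|α| = p`, `|β| = q`): for every index `i = (m, ±, l)` the Harish-Chandra module
`(V i, ρK i, ρ𝔤 i)` of «`ω_{p,q}^{m,±,l} := ω(μ_m, ±i, χ_l)`», the archimedean oscillator representation of §D.1 Steps 1–3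
(`F = ℝ`, `E = ℂ`, hermitian form `diag(I_p, −I_q)`, `ψ_ℝ` standard, splitting `ι_{μ_m}` of [HKS, §1], maximal
`χ_l`-quotient for the centre `U(1)`).  Object-match duty (om) of the module docstring; nothing about it is asserted by
the structure beyond the `(𝔤, K)`-module axioms. [cite: Liu2021, App. D l. 5265–5272; §D.1 Steps 1–3, l. 5215–5222] -/
structure Family : Type 1 where
  /-- ⟨CARRIER⟩ the space of `K_{p,q}`-finite vectors of `ω_{p,q}^{m,±,l}`, `i = (m, ±, l)` -/
  V : Idx → Type
  [instAddCommGroupV : ∀ i, AddCommGroup (V i)]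
  [instModuleV : ∀ i, Module ℂ (V i)]
  /-- ⟨CARRIER⟩ the action of `K_{p,q} = U(p) × U(q)` on `ω_{p,q}^{m,±,l}` -/
  ρK : ∀ i, Representation ℂ (uFormGroup α β).maximalCompact (V i)
  /-- ⟨CARRIER⟩ the action of `𝔲_{p,q}` on `ω_{p,q}^{m,±,l}` -/
  ρ𝔤 : ∀ i, (uFormGroup α β).lie →ₗ⁅ℝ⁆ Module.End ℂ (V i)
  /-- each `(V i, ρK i, ρ𝔤 i)` is a `(𝔤, K)`-module (Wallach §3.3.1; tree `IsGKModule`) -/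
  isGKModule : ∀ i, IsGKModule (uFormGroup α β) (ρK i) (ρ𝔤 i)

attribute [instance] Family.instAddCommGroupV Family.instModuleV

/-- ⟨CARRIER⟩ **the pair `(π^{1,0}_{p,q}, π^{0,1}_{p,q})` of [Liu2021, App. D l. 5274–5276]** (print: `(p,q) = (n−1,1)`) as
`(𝔤, K)`-modules of `uFormGroup α β`; the printed sentence that DEFINES the labels is the predicate `CohPair.AsPrinted`.
[cite: Liu2021, App. D l. 5274–5276] -/
structure CohPair : Type 1 where
  /-- ⟨CARRIER⟩ the Harish-Chandra module of `π^{1,0}` -/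
  V10 : Type
  [instAddCommGroupV10 : AddCommGroup V10]
  [instModuleV10 : Module ℂ V10]
  /-- ⟨CARRIER⟩ `K_{p,q}` on `π^{1,0}` -/
  ρK10 : Representation ℂ (uFormGroup α β).maximalCompact V10
  /-- ⟨CARRIER⟩ `𝔲_{p,q}` on `π^{1,0}` -/
  ρ𝔤10 : (uFormGroup α β).lie →ₗ⁅ℝ⁆ Module.End ℂ V10
  /-- `π^{1,0}` is a `(𝔤, K)`-module -/
  isGKModule10 : IsGKModule (uFormGroup α β) ρK10 ρ𝔤10
  /-- ⟨CARRIER⟩ the Harish-Chandra module of `π^{0,1}` -/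
  V01 : Type
  [instAddCommGroupV01 : AddCommGroup V01]
  [instModuleV01 : Module ℂ V01]
  /-- ⟨CARRIER⟩ `K_{p,q}` on `π^{0,1}` -/
  ρK01 : Representation ℂ (uFormGroup α β).maximalCompact V01
  /-- ⟨CARRIER⟩ `𝔲_{p,q}` on `π^{0,1}` -/
  ρ𝔤01 : (uFormGroup α β).lie →ₗ⁅ℝ⁆ Module.End ℂ V01
  /-- `π^{0,1}` is a `(𝔤, K)`-module -/
  isGKModule01 : IsGKModule (uFormGroup α β) ρK01 ρ𝔤01

attribute [instance] CohPair.instAddCommGroupV10 CohPair.instModuleV10 CohPair.instAddCommGroupV01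
  CohPair.instModuleV01

variable {α β}

/-- «It is well-known (see, for example, [SW78]*Section 4) that `ω_{p,q}^{m,±,l}` is irreducible» — as a predicate on the
family (READING L2: irreducible `(𝔤, K)`-module). [cite: Liu2021, App. D l. 5272] [cite: SternbergWolf1978, §4] -/
def Family.IrreducibleAsPrinted (D : Family α β) : Prop :=
  ∀ i : Idx, IsIrreducibleGK (D.ρK i) (D.ρ𝔤 i)

/-- `H¹(𝔲_{p,q}, K_{p,q}; π^{1,0})` — the tree's relative Lie algebra cohomology of the `(𝔤, K)`-module `π^{1,0}` in degree `1`.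
[cite: Liu2021, App. D l. 5274–5276] [cite: BorelWallach2000, I §5.1] -/
abbrev CohPair.H1_10 (C : CohPair α β) : Type _ :=
  gkCohomology (uFormGroup α β) C.ρK10 C.ρ𝔤10 C.isGKModule10.ad_compat 1

/-- `H¹(𝔲_{p,q}, K_{p,q}; π^{0,1})`. [cite: Liu2021, App. D l. 5274–5276] [cite: BorelWallach2000, I §5.1] -/
abbrev CohPair.H1_01 (C : CohPair α β) : Type _ :=
  gkCohomology (uFormGroup α β) C.ρK01 C.ρ𝔤01 C.isGKModule01.ad_compat 1

/-- **The paragraph l. 5274–5276 AS PRINTED**, the definition of the labels `π^{1,0}`, `π^{0,1}`: «up to equivalence, there are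
only two irreducible unitary representations `π` of `U(n−1,1)_ℝ` such that `H¹(𝔲_{n−1,1}, K_{n−1,1}; π) ≠ {0}`, in which case the
cohomology has dimension `1` for both representations … labelled in the way that `H¹(…; π^{1,0})` and `H¹(…; π^{0,1})` have
Hodge types `(1,0)` and `(0,1)`, respectively»: (a) `π^{1,0}` is irreducible, unitary, `H¹ ≠ 0` of dimension `1`, every class
of type `δ = +1` (`= (1,0)`, READING L3); (b) the same for `π^{0,1}` with `δ = −1`; (c) `π^{1,0} ≄ π^{0,1}`; (d) every
irreducible unitary `(𝔤, K)`-module of `uFormGroup α β` with `H¹ ≠ 0` is equivalent to `π^{1,0}` or to `π^{0,1}` (READING L4).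
A predicate on `C`; print has `(p,q) = (n−1,1)`, i.e. `|β| = 1`, which the consumers `LemD2_2AsPrinted`/`LemD2_3AsPrinted`
carry. [cite: Liu2021, App. D l. 5274–5276] [cite: BergeronMillsonMoeglin2016Balls, §5] -/
def CohPair.AsPrinted (C : CohPair α β) : Prop :=
  (IsIrreducibleGK C.ρK10 C.ρ𝔤10 ∧ IsInfUnitary C.ρK10 C.ρ𝔤10 ∧ Nontrivial C.H1_10 ∧
      Module.finrank ℂ C.H1_10 = 1 ∧ upqTypeClasses C.ρK10 C.ρ𝔤10 C.isGKModule10.ad_compat 1 1 = ⊤) ∧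
  (IsIrreducibleGK C.ρK01 C.ρ𝔤01 ∧ IsInfUnitary C.ρK01 C.ρ𝔤01 ∧ Nontrivial C.H1_01 ∧
      Module.finrank ℂ C.H1_01 = 1 ∧ upqTypeClasses C.ρK01 C.ρ𝔤01 C.isGKModule01.ad_compat 1 (-1) = ⊤) ∧
  ¬ AreGKEquivalent C.ρK10 C.ρ𝔤10 C.ρK01 C.ρ𝔤01 ∧
  ∀ (W : Type) [AddCommGroup W] [Module ℂ W] (σK : Representation ℂ (uFormGroup α β).maximalCompact W)
    (σ𝔤 : (uFormGroup α β).lie →ₗ⁅ℝ⁆ Module.End ℂ W) (hW : IsGKModule (uFormGroup α β) σK σ𝔤),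
    IsIrreducibleGK σK σ𝔤 → IsInfUnitary σK σ𝔤 → Nontrivial (gkCohomology (uFormGroup α β) σK σ𝔤 hW.ad_compat 1) →
      AreGKEquivalent σK σ𝔤 C.ρK10 C.ρ𝔤10 ∨ AreGKEquivalent σK σ𝔤 C.ρK01 C.ρ𝔤01

/-! ## §2 Lemma D.2, items (1)–(3), AS PRINTED -/

/-- **[Liu2021, Lemma D.2 (1)] AS PRINTED** (signature `(p,q) = (n,0)`: `β` empty, `|α| = n ≥ 2` the standing rank of §D.1):
«Among the representations `ω_{n,0}^{m,±,l}`, only `ω_{n,0}^{1,+,0}` and `ω_{n,0}^{−1,−,0}` are the trivial character» — for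
every index `i`, `ω_i` is the trivial character iff `i ∈ {(1,+,0), (−1,−,0)}`.  A predicate on the family `D`.
[cite: Liu2021, App. D Lem. D.2 (1), l. 5282] -/
def LemD2_1AsPrinted (D : Family α β) : Prop :=
  IsEmpty β → 2 ≤ Fintype.card α →
    ∀ i : Idx, IsTrivialCharacter (D.ρK i) (D.ρ𝔤 i) ↔ (i.Is 1 1 0 ∨ i.Is (-1) (-1) 0)

/-- **[Liu2021, Lemma D.2 (2)] AS PRINTED** (signature `(n−1,1)`: `|β| = 1`; «`n ≥ 3`» ⇔ `|α| ≥ 2`): «If `n ≥ 3`, then in the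
set `{ω_{n−1,1}^{m,±,l}}`, only `ω_{n−1,1}^{−1,−,0}` (resp. `ω_{n−1,1}^{1,+,0}`) is isomorphic to `π_{n−1,1}^{1,0}` (resp.
`π_{n−1,1}^{0,1}`)» — for every index `i`: `ω_i ≅ π^{1,0}` iff `i = (−1,−,0)`, and `ω_i ≅ π^{0,1}` iff `i = (1,+,0)`.  A predicate
on the family `D` and the pair `C` (whose defining sentence is `C.AsPrinted`).  The cell's `U(2,1)` case is `α = Fin 2`,
`β = Unit`. [cite: Liu2021, App. D Lem. D.2 (2), l. 5284] -/
def LemD2_2AsPrinted (D : Family α β) (C : CohPair α β) : Prop :=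
  Fintype.card β = 1 → 2 ≤ Fintype.card α →
    ∀ i : Idx,
      (AreGKEquivalent (D.ρK i) (D.ρ𝔤 i) C.ρK10 C.ρ𝔤10 ↔ i.Is (-1) (-1) 0) ∧
        (AreGKEquivalent (D.ρK i) (D.ρ𝔤 i) C.ρK01 C.ρ𝔤01 ↔ i.Is 1 1 0)

/-- **[Liu2021, Lemma D.2 (3)] AS PRINTED** (signature `(1,1)`: `|α| = |β| = 1`): «If `n = 2`, then in the set
`{ω_{1,1}^{m,±,l}}`, only `ω_{1,1}^{−1,−,0}` and `ω_{1,1}^{1,−,0}` (resp. `ω_{1,1}^{1,+,0}` and `ω_{1,1}^{−1,+,0}`) are isomorphic to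
`π_{1,1}^{1,0}` (resp. `π_{1,1}^{0,1}`)». [cite: Liu2021, App. D Lem. D.2 (3), l. 5286] -/
def LemD2_3AsPrinted (D : Family α β) (C : CohPair α β) : Prop :=
  Fintype.card α = 1 → Fintype.card β = 1 →
    ∀ i : Idx,
      (AreGKEquivalent (D.ρK i) (D.ρ𝔤 i) C.ρK10 C.ρ𝔤10 ↔ (i.Is (-1) (-1) 0 ∨ i.Is 1 (-1) 0)) ∧
        (AreGKEquivalent (D.ρK i) (D.ρ𝔤 i) C.ρK01 C.ρ𝔤01 ↔ (i.Is 1 1 0 ∨ i.Is (-1) 1 0))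

/-! ## §3 The shapes in which item (2) is consumed (proved unfoldings) -/

/-- item (2), «`ω^{−1,−,0}_{n−1,1} ≅ π^{1,0}_{n−1,1}`». [cite: Liu2021, App. D Lem. D.2 (2), l. 5284] -/
theorem LemD2_2AsPrinted.equiv_pi10 {D : Family α β} {C : CohPair α β} (h : LemD2_2AsPrinted D C)
    (hβ : Fintype.card β = 1) (hα : 2 ≤ Fintype.card α) (i : Idx) (hi : i.Is (-1) (-1) 0) :
    AreGKEquivalent (D.ρK i) (D.ρ𝔤 i) C.ρK10 C.ρ𝔤10 :=
  ((h hβ hα i).1).2 hi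

/-- item (2), «`ω^{1,+,0}_{n−1,1} ≅ π^{0,1}_{n−1,1}`». [cite: Liu2021, App. D Lem. D.2 (2), l. 5284] -/
theorem LemD2_2AsPrinted.equiv_pi01 {D : Family α β} {C : CohPair α β} (h : LemD2_2AsPrinted D C)
    (hβ : Fintype.card β = 1) (hα : 2 ≤ Fintype.card α) (i : Idx) (hi : i.Is 1 1 0) :
    AreGKEquivalent (D.ρK i) (D.ρ𝔤 i) C.ρK01 C.ρ𝔤01 :=
  ((h hβ hα i).2).2 hi

/-- item (2), the «only» clause for `π^{1,0}`: an `ω_i` equivalent to `π^{1,0}` has `(m, ±, l) = (−1, −, 0)` — the form used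
at l. 2140 («By Lemma D.2, we know that `μ` is of weight one and `ε_e` is `μ`-admissible»).
[cite: Liu2021, App. D Lem. D.2 (2), l. 5284; proof of Prop. 4.13, l. 2140] -/
theorem LemD2_2AsPrinted.is_of_equiv_pi10 {D : Family α β} {C : CohPair α β} (h : LemD2_2AsPrinted D C)
    (hβ : Fintype.card β = 1) (hα : 2 ≤ Fintype.card α) (i : Idx)
    (he : AreGKEquivalent (D.ρK i) (D.ρ𝔤 i) C.ρK10 C.ρ𝔤10) : i.m = -1 ∧ i.sgn = -1 ∧ i.l = 0 :=
  ((h hβ hα i).1).1 he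

/-- item (2), the «only» clause for `π^{0,1}`: an `ω_i` equivalent to `π^{0,1}` has `(m, ±, l) = (1, +, 0)`.
[cite: Liu2021, App. D Lem. D.2 (2), l. 5284; proof of Prop. 4.13, l. 2140] -/
theorem LemD2_2AsPrinted.is_of_equiv_pi01 {D : Family α β} {C : CohPair α β} (h : LemD2_2AsPrinted D C)
    (hβ : Fintype.card β = 1) (hα : 2 ≤ Fintype.card α) (i : Idx)
    (he : AreGKEquivalent (D.ρK i) (D.ρ𝔤 i) C.ρK01 C.ρ𝔤01) : i.m = 1 ∧ i.sgn = 1 ∧ i.l = 0 :=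
  ((h hβ hα i).2).1 he

/-- with the defining paragraph: an `ω_i` of `U(n−1,1)_ℝ`, `n ≥ 3`, which is irreducible, unitary and has `H¹ ≠ 0` is
`ω^{−1,−,0}` or `ω^{1,+,0}` — the dichotomy behind «`μ` is of weight one and `ε_e` is `μ`-admissible» (l. 2140).
[cite: Liu2021, App. D l. 5274–5276, Lem. D.2 (2) l. 5284; proof of Prop. 4.13, l. 2140] -/
theorem LemD2_2AsPrinted.is_or_is_of_h1_nontrivial {D : Family α β} {C : CohPair α β} (h : LemD2_2AsPrinted D C)
    (hC : C.AsPrinted) (hβ : Fintype.card β = 1) (hα : 2 ≤ Fintype.card α) (i : Idx)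
    (hirr : IsIrreducibleGK (D.ρK i) (D.ρ𝔤 i)) (hu : IsInfUnitary (D.ρK i) (D.ρ𝔤 i))
    (hH : Nontrivial (gkCohomology (uFormGroup α β) (D.ρK i) (D.ρ𝔤 i) (D.isGKModule i).ad_compat 1)) :
    i.Is (-1) (-1) 0 ∨ i.Is 1 1 0 := by
  rcases hC.2.2.2 (D.V i) (D.ρK i) (D.ρ𝔤 i) (D.isGKModule i) hirr hu hH with he | he
  · exact Or.inl (((h hβ hα i).1).1 he)
  · exact Or.inr (((h hβ hα i).2).1 he)

end LemD2

end Literature.NumberTheory.Automorphic.Liu2021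

end
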